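import Summits.HodgeConjecture.HodgeConjecture.Theorems.R90S4SimilConjOfNormRatio      -- ★ (F2a) `comap_cmDatumLocalCongr_eq_of_norm` (hand p04, p861539)
import Summits.HodgeConjecture.HodgeConjecture.Theorems.R90S4FixedUnitsModNormsLeTwo    -- ★ (F2b) `exists_fixed_units_mod_norms_card_le_two` (hand p04, p861582)
import HarnessLib

/-!
# R90-TF · S4 (Ch. 13.1–2) · hand p04 — (F2c) the SIMILITUDE ORBIT of a class of `U(Φ₂)(L⁺_v)` is a FINSET with AT MOST TWO elements
# (Rogawski Prop. 11.1.1 (a): «all L-packets of `U(2)` have one or two elements»; the orbit exists as a finset at EVERY finite place)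

Cell `hodgecm-mathlib`, crux H413 (`stmt-HodgeConjecture-24833`), route of record `HCCMUnconditional`; programme R90-TF (brief
`director/R90-BRIEF.v2.md` 1f40d54518340a35), section S4 = Rogawski Ch. 13.1–2 (base `R90-C131`), seat R90-C131-p04 (g0), socket S4#B3
`R90.S4.stub_R90_S4_H_cover` (`Cruxes/H413/Lines/R90_S4_HPacketsU2B.lean` :338) ROAD «SCHUR ⊠-SPLITTING + FINITE ORBIT», step (F2c) = the «FINITE ORBIT»
half, with the bound `≤ 2` thrown in (so that S4#B4 `_card`, hand p03, reads `O.card ≤ 2` off the same finset).  Lane `--supports stmt-HodgeConjecture-24833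
--as helper`; ONE public theorem, no definition, no instance, no notation, no `sorry`.  NAME-SHAPE: the orbit predicate below is file B's
`R90.S4.IsU2SimilConj L v σ₀ c` with `Φ₂Loc`, `U2Loc` unfolded (Theorems may not import `Cruxes/…`; the abbreviations unfold reducibly).

THE MATHEMATICS ([Rogawski1990, §11.1 p. 161 and Prop. 11.1.1 (a)]; [PlatonovRapinchuk1994, §2.3]).  The `G_ad(F) = PGL₂(F)`-orbit of a class `σ₀` of
`U(Φ₂)(L⁺_v)` is `{σ₀ ∘ Ad(T) : ᵗT̄ Φ₂ T = a Φ₂}` (★ `cmDatumLocalCongr`, ★ `IrrClass.comap`).  The multiplier `a` is `(c ⊗ 1)`-fixed (★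
`conjLocal_eq_self_of_formCongr_eq_smul_antidiag`, `Φ₂` hermitian with an entry `1`); by (F2b) `a = z̄ z · r` with `r` in a set `R` of at most two fixed
units; `T_r := diag(r, 1)` is a similitude with multiplier `r` (`diag(r̄, 1) Φ₂ diag(r, 1) = r Φ₂` for `r̄ = r`); and by (F2a) `σ₀ ∘ Ad(T) = σ₀ ∘ Ad(T_r)`
as classes.  Hence the orbit is the image of `R` under `r ↦ σ₀ ∘ Ad(T_r)`: a finset `O` with `#O ≤ #R ≤ 2` whose members are exactly the similitude
conjugates of `σ₀`.

HONEST LABEL: HC_CM is proved only modulo the 7 printed citations (2 remaining named inputs: hLiu418 = stmt-HodgeConjecture-24832, h413 =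
stmt-HodgeConjecture-24833) until rung 0 closes; this file is local group theory over ★ currency and discharges none of them.  REL ≠ ★ ≠ BUILT.

## References
* [Rogawski1990] J. D. Rogawski, *Automorphic Representations of Unitary Groups in Three Variables*, Ann. of Math. Stud. 123 (1990), §11.1 p. 161, Prop. 11.1.1 (a).
* [PlatonovRapinchuk1994] V. Platonov, A. Rapinchuk, *Algebraic Groups and Number Theory* (1994), §2.3.
-/

set_option autoImplicit false
set_option linter.dupNamespace false

noncomputable section

open NumberField IsDedekindDomain
open scoped Matrix MatrixGroups
open Literature.NumberTheory.Automorphic Literature.NumberTheory.Automorphic.UnitaryGroup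

namespace Summit.HodgeConjecture.HodgeConjecture.R90.S4

variable (L : Type) [Field L] [NumberField L] [IsCMField L] (v : HeightOneSpectrum (𝓞 ↥(maximalRealSubfield L)))

/-- `T_r := diag(r, 1)` is a similitude of `(Φ₂)_v` with multiplier `r` when `r̄ = r`: `ᵗ(diag(r̄, 1)) · Φ₂ · diag(r, 1) = r • Φ₂`.
[cite: Rogawski1990, §11.1 p. 161] [cite: PlatonovRapinchuk1994, §2.3] -/
private theorem formCongr_diagonal_eq_smul {r : LocalRing L v} (hr : IsUnit (![r, 1] : Fin 2 → LocalRing L v))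
    (hσr : conjLocal L (IsCMField.complexConj L) v r = r) :
    formCongr (conjLocal L (IsCMField.complexConj L) v)
        (Units.map ((Matrix.diagonalRingHom (Fin 2) (LocalRing L v) : (Fin 2 → LocalRing L v) →+* Matrix (Fin 2) (Fin 2) (LocalRing L v)) :
          (Fin 2 → LocalRing L v) →* Matrix (Fin 2) (Fin 2) (LocalRing L v)) hr.unit)
        ((Matrix.of fun i j : Fin 2 => if i.val + j.val + 1 = 2 then (1 : L) else 0).map (algebraMap L (LocalRing L v))) =
      r • (Matrix.of fun i j : Fin 2 => if i.val + j.val + 1 = 2 then (1 : L) else 0).map (algebraMap L (LocalRing L v)) := by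
  have hT : Units.val (Units.map ((Matrix.diagonalRingHom (Fin 2) (LocalRing L v) : (Fin 2 → LocalRing L v) →+* Matrix (Fin 2) (Fin 2) (LocalRing L v)) :
      (Fin 2 → LocalRing L v) →* Matrix (Fin 2) (Fin 2) (LocalRing L v)) hr.unit) = Matrix.diagonal ![r, 1] := by
    rw [Units.coe_map, MonoidHom.coe_coe, IsUnit.unit_spec, Matrix.diagonalRingHom_apply]
  have hmap : (![r, 1] : Fin 2 → LocalRing L v) = fun i => conjLocal L (IsCMField.complexConj L) v (![r, 1] i) := by
    funext i
    fin_cases i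
    · exact hσr.symm
    · exact (map_one _).symm
  rw [formCongr, hT, Matrix.diagonal_map (map_zero _), ← hmap, Matrix.diagonal_transpose]
  ext i j
  rw [Matrix.mul_diagonal, Matrix.diagonal_mul, Matrix.smul_apply, Matrix.map_apply, Matrix.of_apply, smul_eq_mul]
  fin_cases i <;> fin_cases j <;> simp

/-- **(F2c) The similitude orbit of a class of `U(Φ₂)(L⁺_v)` is a finset with at most two elements.**  For every `σ₀ ∈ Irr(U(Φ₂)(L⁺_v))` there is
a finset `O` with `#O ≤ 2` whose members are EXACTLY the classes `σ₀ ∘ Ad(T)` for local similitudes `T` of `(Φ₂)_v` (`ᵗT̄ (Φ₂)_v T = a (Φ₂)_v`, `a` a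
unit) — the `PGL₂(F)`-orbit of `σ₀`, i.e. file B's `{c | R90.S4.IsU2SimilConj L v σ₀ c}` (NAME-SHAPE, abbreviations unfolded).  `O` is the image of the
`≤ 2` representatives of the fixed units modulo norms (★ (F2b)) under `r ↦ σ₀ ∘ Ad(diag(r, 1))`, by ★ (F2a).
[cite: Rogawski1990, §11.1 p. 161; Prop. 11.1.1 (a) p. 161] [cite: PlatonovRapinchuk1994, §2.3] -/
theorem exists_finset_similOrbit_card_le_two
    (σ₀ : IrrClass ((cmDatum L 2 (Matrix.of fun i j : Fin 2 => if i.val + j.val + 1 = 2 then (1 : L) else 0)).Local v)) :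
    ∃ O : Finset (IrrClass ((cmDatum L 2 (Matrix.of fun i j : Fin 2 => if i.val + j.val + 1 = 2 then (1 : L) else 0)).Local v)),
      O.card ≤ 2 ∧
      ∀ c : IrrClass ((cmDatum L 2 (Matrix.of fun i j : Fin 2 => if i.val + j.val + 1 = 2 then (1 : L) else 0)).Local v),
        c ∈ O ↔
          ∃ (T : GL (Fin 2) (LocalRing L v)) (a : LocalRing L v) (ha : IsUnit a)
            (h : formCongr (conjLocal L (IsCMField.complexConj L) v) T
                ((Matrix.of fun i j : Fin 2 => if i.val + j.val + 1 = 2 then (1 : L) else 0).map (algebraMap L (LocalRing L v))) =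
              a • (Matrix.of fun i j : Fin 2 => if i.val + j.val + 1 = 2 then (1 : L) else 0).map (algebraMap L (LocalRing L v))),
            c = IrrClass.comap (cmDatumLocalCongr L v T ha h) σ₀ := by
  classical
  obtain ⟨R, hRcard, hR, hrep⟩ := exists_fixed_units_mod_norms_card_le_two L v
  -- the similitude `diag(r, 1)` for `r ∈ R`
  have hRu : ∀ r ∈ R, IsUnit (![r, 1] : Fin 2 → LocalRing L v) := fun r hr =>
    Pi.isUnit_iff.2 fun i => by
      fin_cases i
      · exact (hR r hr).1
      · exact isUnit_one
  let f : {r // r ∈ R} → IrrClass ((cmDatum L 2 (Matrix.of fun i j : Fin 2 => if i.val + j.val + 1 = 2 then (1 : L) else 0)).Local v) :=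
    fun x => IrrClass.comap
      (cmDatumLocalCongr L v
        (Units.map ((Matrix.diagonalRingHom (Fin 2) (LocalRing L v) : (Fin 2 → LocalRing L v) →+* Matrix (Fin 2) (Fin 2) (LocalRing L v)) :
          (Fin 2 → LocalRing L v) →* Matrix (Fin 2) (Fin 2) (LocalRing L v)) (hRu x.1 x.2).unit)
        (hR x.1 x.2).1 (formCongr_diagonal_eq_smul L v (hRu x.1 x.2) (hR x.1 x.2).2)) σ₀
  refine ⟨R.attach.image f, (Finset.card_image_le).trans (by rw [Finset.card_attach]; exact hRcard), fun c => ⟨fun hc => ?_, ?_⟩⟩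
  · -- members of `O` are similitude conjugates
    obtain ⟨x, -, rfl⟩ := Finset.mem_image.1 hc
    exact ⟨_, x.1, (hR x.1 x.2).1, formCongr_diagonal_eq_smul L v (hRu x.1 x.2) (hR x.1 x.2).2, rfl⟩
  · -- every similitude conjugate is `σ₀ ∘ Ad(diag(r, 1))` for the representative `r` of the class of its multiplier
    rintro ⟨T, a, ha, h, rfl⟩
    have haσ : conjLocal L (IsCMField.complexConj L) v a = a :=
      conjLocal_eq_self_of_formCongr_eq_smul_antidiag L (N := 2) two_ne_zero (antidiagOne_isHermitian L 2) v T h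
    obtain ⟨r, hr, z, hz⟩ := hrep a ha haσ
    refine Finset.mem_image.2 ⟨⟨r, hr⟩, Finset.mem_attach _ _, ?_⟩
    exact (comap_cmDatumLocalCongr_eq_of_norm L v _ T (hR r hr).1 ha (formCongr_diagonal_eq_smul L v (hRu r hr) (hR r hr).2) h z hz σ₀).symm

end Summit.HodgeConjecture.HodgeConjecture.R90.S4

end
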